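import Summits.Ventures.LatticeQCDFlow.Scaling.SwapSpacingOptimum
import Summits.Ventures.LatticeQCDFlow.Scaling.SwapSpacingBrackets

/-!
HONEST FRAMING: exact (Metropolis-corrected) sampling algorithms for lattice gauge theory; figures
of merit are autocorrelation/cost numbers at stated couplings and volumes; no continuum-physics
claim.

# SwapAcceptanceOptimum — THE MODEL'S OPTIMAL SWAP ACCEPTANCE IS UNIVERSAL AND LIES IN `(0.2302, 0.2364)`;
# THE CARD'S TARGET `0.20` SITS AT REDUCED SPACING `u₂₀ ∈ (0.9, 1) > u⋆ ∈ (0.82, 0.87)` AND RETAINS MORE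
# THAN `92 %` OF THE OPTIMAL EFFICIENCY (row 22 `su3-ptbc`, GEN-4, ours; part 2 of 2, sequel of
# `Scaling/SwapSpacingOptimum`, numerics from `Scaling/SwapSpacingBrackets`)

Venture `LatticeQCDFlow` (cell pub-lqcd), topic `Scaling`; FANOUT row 22 (`su3-ptbc`).  NEW WORK of the
cell over part 1 (`swapEff u = u²·erfc u`, its unique maximiser `uOpt = u⋆` with
`swapCrit u⋆ = erfc u⋆ − u⋆e^{−u⋆²}/√π = 0`, `aOpt = a⋆ = erfc u⋆`, the bracketing criteria
`lt_uOpt_of_swapCrit_pos` / `uOpt_lt_of_swapCrit_neg`) and the certified point brackets of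
`SwapSpacingBrackets` (`erfc 0.82 > 0.2460`, `erfc 0.87 < 0.2199`, `erfc 0.9 > 1/5 > erfc 1`,
`0.23024 < optAccFn 0.87 < 0.23053`, `optAccFn 0.82 < 0.23633`, `optAccFn u = u·e^{−u²}/√π`).  Nothing
is cited as a fact.

## What is proved

* §1 (model step (M2) of part 1, physical units) `swapESJD ℓ = ℓ²·erfc(ℓ/(2√2))`, **`swapESJD_eq`**
  (`= 8·swapEff(ℓ/(2√2))`), `optSpacing = ℓ⋆ = 2√2·u⋆`, **`swapESJD_lt_of_ne`** (`ℓ⋆` is the unique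
  maximiser on `ℓ ≥ 0`), `erfc_optSpacing` (the acceptance AT `ℓ⋆` is `a⋆`); `ladderCost Λ ℓ =
  (Λ/ℓ)²/erfc(ℓ/(2√2))` (round trips of a replica on a uniform ladder of total stiffness `Λ`),
  `ladderCost_eq` (`= Λ²/ESJD(ℓ)`), **`ladderCost_opt_le`** / `ladderCost_opt_lt` — UNIVERSALITY: for EVERY
  `Λ` the cost is minimised at the same spacing `ℓ⋆`, where every pair accepts with probability `a⋆`; the
  total stiffness (hence `β`, `L`, the defect size `L_d`, the gauge group) only sets HOW MANY pairs, not
  their acceptance — the model's reason for the printed practice "tune all adjacent swap rates to one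
  target" (Bonanno–Bonati–D'Elia 2021; CARD-su3-ptbc §1.6 `replicas.c_tuning = equal-acceptance`).
* §2 **`uOpt_mem_Ioo_082_087`** (`0.82 < u⋆ < 0.87`, from the certified signs `swapCrit 0.82 > 0 >
  swapCrit 0.87`); `strictAntiOn_optAccFn` (`u ↦ ue^{−u²}/√π` decreases on `[3/4, ∞)`); **`aOpt_bounds`**
  (`0.2302 < a⋆ < 0.2364`) and the rounded **`aOpt_mem_Ioo`** (`0.23 < a⋆ < 0.24`): the model's optimum
  is the printed `0.234` of Roberts–Gelman–Gilks, Ann. Appl. Probab. 7 (1997) 110 /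
  Atchadé–Roberts–Rosenthal, Stat. Comput. 21 (2011) 555, NAMED ONLY, here for the exact `erfc` model with
  no asymptotics; `one_fifth_lt_aOpt`; `cubeExpFn`, `monotoneOn_cubeExpFn`, **`swapEff_uOpt_lt`** (the
  maximal efficiency is `< 0.17449`).
* §3 the card's target: `exists_erfc_eq_one_fifth`, **`uTwenty`** (the reduced spacing at which a pair
  accepts with probability exactly `0.20`), `uTwenty_mem_Ioo` (`0.9 < u₂₀ < 1`), `erfc_eq_one_fifth_iff`,
  **`uOpt_lt_uTwenty`** (the `20 %` ladder is MORE WIDELY spaced than the optimum, i.e. uses fewer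
  replicas: `N_r − 1 = Λ/(2√2·u)`), `swapEff_uTwenty_gt` (`> 0.162`),
  **`swapEff_uTwenty_gt_mul_swapEff_uOpt`** (`swapEff u₂₀ > 0.92·swapEff u⋆`) and `swapESJD_twenty_gt`:
  in the model the card's `swap_acc_target = 0.20` costs less than `8 %` in round-trip efficiency
  relative to the optimum `a⋆ ≈ 0.234` (Kone–Kofke 2005 / Rathore–Chopra–de Pablo 2005 print `≈ 20 %`
  from related cost models, NAMED ONLY).

NOT CLAIMED: that the Gaussian swap / diffusive-cost model describes PTBC at the card's points (CARD §9
measures it); sharper digits of `u⋆`, `a⋆`; any statement about a run.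
-/

noncomputable section

open Real Set MeasureTheory Finset Filter Topology
open Literature.Analysis.SpecialFunctions (erf)
open Literature.ComputerArithmetic.BrentZimmermann2010.AsymptoticExpansions (erfc erfc_pos)

namespace Summit.Ventures.LatticeQCDFlow.Scaling

/-! ## §1 Physical units and universality (model step (M2)) -/

section Universal

/-- **ESJD of a swap pair at stiffness distance `ℓ`** in the Gaussian swap model: squared displacement
`ℓ²` times the acceptance `erfc(ℓ/(2√2))`. [ours] -/
def swapESJD (ℓ : ℝ) : ℝ := ℓ ^ 2 * erfc (ℓ / (2 * sqrt 2))

/-- `(2√2)² = 8`. [folklore] -/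
theorem two_mul_sqrt_two_sq : (2 * sqrt 2) ^ 2 = (8 : ℝ) := by
  rw [mul_pow, sq_sqrt (by norm_num : (0 : ℝ) ≤ 2)]; norm_num

/-- `2√2 > 0`. [folklore] -/
theorem two_mul_sqrt_two_pos : (0 : ℝ) < 2 * sqrt 2 := by positivity

/-- **`ESJD(ℓ) = 8·swapEff(ℓ/(2√2))`.** [ours] -/
theorem swapESJD_eq (ℓ : ℝ) : swapESJD ℓ = 8 * swapEff (ℓ / (2 * sqrt 2)) := by
  simp only [swapESJD, swapEff, div_pow, two_mul_sqrt_two_sq]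
  ring

/-- **The optimal spacing** `ℓ⋆ = 2√2·u⋆` in stiffness units. [ours] -/
def optSpacing : ℝ := 2 * sqrt 2 * uOpt

/-- `ℓ⋆ > 0`. [ours] -/
theorem optSpacing_pos : 0 < optSpacing := mul_pos two_mul_sqrt_two_pos uOpt_pos

/-- `ℓ⋆/(2√2) = u⋆`. [ours] -/
theorem optSpacing_div : optSpacing / (2 * sqrt 2) = uOpt := by
  rw [optSpacing, mul_div_cancel_left₀ _ two_mul_sqrt_two_pos.ne']

/-- **The acceptance at the optimal spacing is `a⋆`.** [ours] -/
theorem erfc_optSpacing : erfc (optSpacing / (2 * sqrt 2)) = aOpt := by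
  rw [optSpacing_div]; rfl

/-- **`ℓ⋆` is the unique maximiser of `ESJD` on `ℓ ≥ 0`.** [ours] -/
theorem swapESJD_lt_of_ne {ℓ : ℝ} (hℓ : 0 ≤ ℓ) (hne : ℓ ≠ optSpacing) : swapESJD ℓ < swapESJD optSpacing := by
  rw [swapESJD_eq, swapESJD_eq, optSpacing_div]
  have hu0 : 0 ≤ ℓ / (2 * sqrt 2) := div_nonneg hℓ two_mul_sqrt_two_pos.le
  have hne' : ℓ / (2 * sqrt 2) ≠ uOpt := by
    intro h
    apply hne
    rw [optSpacing, ← h]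
    field_simp
  have := swapEff_lt_swapEff_uOpt hu0 hne'
  linarith

/-- `ESJD(ℓ) ≤ ESJD(ℓ⋆)` for every `ℓ ≥ 0`. [ours] -/
theorem swapESJD_le {ℓ : ℝ} (hℓ : 0 ≤ ℓ) : swapESJD ℓ ≤ swapESJD optSpacing := by
  by_cases h : ℓ = optSpacing
  · rw [h]
  · exact (swapESJD_lt_of_ne hℓ h).le

/-- `ESJD(ℓ) > 0` for `ℓ > 0`. [ours] -/
theorem swapESJD_pos {ℓ : ℝ} (hℓ : 0 < ℓ) : 0 < swapESJD ℓ := mul_pos (pow_pos hℓ 2) (erfc_pos _)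

/-- **The diffusive round-trip cost** of covering total stiffness `Λ` with uniform spacing `ℓ`:
`(Λ/ℓ)²` intervals-squared divided by the acceptance `erfc(ℓ/(2√2))` (model step (M2)). [ours] -/
def ladderCost (Λ ℓ : ℝ) : ℝ := (Λ / ℓ) ^ 2 / erfc (ℓ / (2 * sqrt 2))

/-- **`ladderCost Λ ℓ = Λ²/ESJD(ℓ)`** (for `ℓ = 0` both sides are the junk value `0`). [ours] -/
theorem ladderCost_eq (Λ ℓ : ℝ) : ladderCost Λ ℓ = Λ ^ 2 / swapESJD ℓ := by
  simp only [ladderCost, swapESJD]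
  rw [div_pow, div_div]

/-- **UNIVERSALITY OF THE OPTIMAL ACCEPTANCE.**  For EVERY total stiffness `Λ` (hence every `β`, `L`,
defect size and gauge group, which enter the model only through `Λ`) and every spacing `ℓ > 0`, the
round-trip cost at the spacing `ℓ⋆` — where every pair accepts with probability `a⋆` — is at most the cost
at `ℓ`: the cost-optimal ladder is the one tuned to the universal acceptance `a⋆`. [ours] -/
theorem ladderCost_opt_le (Λ : ℝ) {ℓ : ℝ} (hℓ : 0 < ℓ) : ladderCost Λ optSpacing ≤ ladderCost Λ ℓ := by
  rw [ladderCost_eq Λ ℓ, ladderCost_eq Λ optSpacing]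
  exact div_le_div_of_nonneg_left (sq_nonneg Λ) (swapESJD_pos hℓ) (swapESJD_le hℓ.le)

/-- Strict form: any other positive spacing is strictly more expensive when `Λ ≠ 0`. [ours] -/
theorem ladderCost_opt_lt {Λ : ℝ} (hΛ : Λ ≠ 0) {ℓ : ℝ} (hℓ : 0 < ℓ) (hne : ℓ ≠ optSpacing) :
    ladderCost Λ optSpacing < ladderCost Λ ℓ := by
  rw [ladderCost_eq Λ ℓ, ladderCost_eq Λ optSpacing]
  exact div_lt_div_of_pos_left (by positivity) (swapESJD_pos hℓ) (swapESJD_lt_of_ne hℓ.le hne)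

end Universal


/-! ## §2 The enclosure: `0.82 < u⋆ < 0.87` and `0.2302 < a⋆ < 0.2364` -/



section Enclosure

/-- `swapCrit = erfc − optAccFn`. [ours] -/
theorem swapCrit_eq_erfc_sub (u : ℝ) : swapCrit u = erfc u - optAccFn u := rfl

/-- `a⋆ = optAccFn u⋆`. [ours] -/
theorem aOpt_eq_optAccFn : aOpt = optAccFn uOpt := aOpt_eq


/-- **`swapCrit 0.82 > 0`** (`erfc 0.82 > 0.2460 > 0.23633 > optAccFn 0.82`). [ours] -/
theorem swapCrit_082_pos : 0 < swapCrit (41 / 50) := by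
  rw [swapCrit_eq_erfc_sub]
  linarith [erfc_082_gt, optAccFn_082_lt]

/-- **`swapCrit 0.87 < 0`** (`erfc 0.87 < 0.2199 < 0.23024 < optAccFn 0.87`). [ours] -/
theorem swapCrit_087_neg : swapCrit (87 / 100) < 0 := by
  rw [swapCrit_eq_erfc_sub]
  linarith [erfc_087_lt, optAccFn_087_gt]

/-- **`0.82 < u⋆ < 0.87`.** [ours] -/
theorem uOpt_mem_Ioo_082_087 : uOpt ∈ Ioo (41 / 50 : ℝ) (87 / 100) :=
  ⟨lt_uOpt_of_swapCrit_pos swapCrit_082_pos, uOpt_lt_of_swapCrit_neg (by norm_num) swapCrit_087_neg⟩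

/-- `optAccFn` is continuous. [ours] -/
theorem continuous_optAccFn : Continuous optAccFn :=
  (show Differentiable ℝ optAccFn from fun u => (hasDerivAt_mul_exp_neg_sq u).differentiableAt).continuous

/-- **`u ↦ u·e^{−u²}/√π` is strictly decreasing on `[3/4, ∞)`** (derivative `e^{−u²}(1 − 2u²)/√π < 0`
once `u² > 1/2`). [ours] -/
theorem strictAntiOn_optAccFn : StrictAntiOn optAccFn (Ici (3 / 4)) := by
  refine strictAntiOn_of_deriv_neg (convex_Ici _) continuous_optAccFn.continuousOn fun x hx => ?_
  rw [interior_Ici] at hx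
  have hd : deriv optAccFn x = exp (-(x ^ 2)) * (1 - 2 * x ^ 2) / sqrt π :=
    (hasDerivAt_mul_exp_neg_sq x).deriv
  rw [hd]
  have hx' : (3 / 4 : ℝ) < x := hx
  have hneg : 1 - 2 * x ^ 2 < 0 := by nlinarith
  have hpos : 0 < exp (-(x ^ 2)) / sqrt π := by positivity
  calc exp (-(x ^ 2)) * (1 - 2 * x ^ 2) / sqrt π = (exp (-(x ^ 2)) / sqrt π) * (1 - 2 * x ^ 2) := by ring
    _ < 0 := mul_neg_of_pos_of_neg hpos hneg

/-- **`0.2302 < a⋆ < 0.2364`**: `a⋆ = optAccFn u⋆` lies between `optAccFn 0.87 > 0.23024` and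
`optAccFn 0.82 < 0.23633`. [ours] -/
theorem aOpt_bounds : (0.2302 : ℝ) < aOpt ∧ aOpt < 0.2364 := by
  obtain ⟨hlo, hhi⟩ := uOpt_mem_Ioo_082_087
  rw [aOpt_eq_optAccFn]
  have h34 : (3 / 4 : ℝ) ≤ 41 / 50 := by norm_num
  have hA : optAccFn uOpt < optAccFn (41 / 50) :=
    strictAntiOn_optAccFn (show (3 / 4 : ℝ) ≤ 41 / 50 from h34) (show (3 / 4 : ℝ) ≤ uOpt by linarith) hlo
  have hB : optAccFn (87 / 100) < optAccFn uOpt :=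
    strictAntiOn_optAccFn (show (3 / 4 : ℝ) ≤ uOpt by linarith) (show (3 / 4 : ℝ) ≤ 87 / 100 by norm_num) hhi
  constructor
  · linarith [optAccFn_087_gt]
  · linarith [optAccFn_082_lt]

/-- **THE MODEL'S OPTIMAL SWAP ACCEPTANCE IS `23–24 %`** (the printed `0.234`). [ours] -/
theorem aOpt_mem_Ioo : aOpt ∈ Ioo (0.23 : ℝ) 0.24 :=
  ⟨by linarith [aOpt_bounds.1], by linarith [aOpt_bounds.2]⟩

/-- The optimal acceptance exceeds the card's target `1/5`. [ours] -/
theorem one_fifth_lt_aOpt : (1 / 5 : ℝ) < aOpt := by linarith [aOpt_bounds.1]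

/-- The efficiency at the optimum as a function of the spacing: `cubeExpFn u = u³e^{−u²}/√π`
(`swapEff u⋆ = cubeExpFn u⋆`, `swapEff_uOpt`). [ours] -/
def cubeExpFn (u : ℝ) : ℝ := u ^ 3 * exp (-(u ^ 2)) / sqrt π

/-- `cubeExpFn u = u²·optAccFn u`. [ours] -/
theorem cubeExpFn_eq (u : ℝ) : cubeExpFn u = u ^ 2 * optAccFn u := by
  simp only [cubeExpFn, optAccFn]; ring

/-- `cubeExpFn′(u) = (3u² − 2u⁴)e^{−u²}/√π`. [ours] -/
theorem hasDerivAt_cubeExpFn (u : ℝ) :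
    HasDerivAt cubeExpFn ((3 * u ^ 2 - 2 * u ^ 4) * exp (-(u ^ 2)) / sqrt π) u := by
  have h1 : HasDerivAt (fun v : ℝ => v ^ 2) (2 * u) u := by simpa using hasDerivAt_pow 2 u
  have h2 : HasDerivAt (fun v : ℝ => v ^ 2 * (v * exp (-(v ^ 2)) / sqrt π))
      (2 * u * (u * exp (-(u ^ 2)) / sqrt π) + u ^ 2 * (exp (-(u ^ 2)) * (1 - 2 * u ^ 2) / sqrt π)) u :=
    h1.mul (hasDerivAt_mul_exp_neg_sq u)
  have e : (fun v : ℝ => v ^ 2 * (v * exp (-(v ^ 2)) / sqrt π)) = cubeExpFn := by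
    funext v; simp only [cubeExpFn]; ring
  rw [e] at h2
  convert h2 using 1
  field_simp
  ring

/-- **`cubeExpFn` is monotone on `[0, 6/5]`** (derivative `u²(3 − 2u²)e^{−u²}/√π ≥ 0` while `u² ≤ 3/2`).
[ours] -/
theorem monotoneOn_cubeExpFn : MonotoneOn cubeExpFn (Icc 0 (6 / 5)) := by
  have hdiff : Differentiable ℝ cubeExpFn := fun u => (hasDerivAt_cubeExpFn u).differentiableAt
  refine monotoneOn_of_deriv_nonneg (convex_Icc _ _) hdiff.continuous.continuousOn
    (hdiff.differentiableOn) fun x hx => ?_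
  rw [interior_Icc] at hx
  rw [(hasDerivAt_cubeExpFn x).deriv]
  have h1 : 0 ≤ 3 * x ^ 2 - 2 * x ^ 4 := by
    have hx2 : x ^ 2 ≤ 36 / 25 := by nlinarith [hx.1, hx.2]
    nlinarith [sq_nonneg x]
  positivity

/-- **The maximal efficiency is `swapEff u⋆ < 0.17449`** (`= cubeExpFn u⋆ ≤ cubeExpFn 0.87 =
0.87²·optAccFn 0.87 < 0.7569 · 0.23053`). [ours] -/
theorem swapEff_uOpt_lt : swapEff uOpt < (0.17449 : ℝ) := by
  obtain ⟨hlo, hhi⟩ := uOpt_mem_Ioo_082_087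
  have h1 : swapEff uOpt = cubeExpFn uOpt := swapEff_uOpt
  have h2 : cubeExpFn uOpt ≤ cubeExpFn (87 / 100) :=
    monotoneOn_cubeExpFn ⟨uOpt_pos.le, by linarith⟩ ⟨by norm_num, by norm_num⟩ hhi.le
  rw [h1]
  refine lt_of_le_of_lt h2 ?_
  rw [cubeExpFn_eq]
  have h3 := optAccFn_087_lt
  have h4 : 0 < optAccFn (87 / 100) := by linarith [optAccFn_087_gt]
  nlinarith

end Enclosure

/-! ## §3 The card's target `0.20`: its reduced spacing `u₂₀` and its efficiency relative to the optimum -/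

section Twenty

/-- A pair accepts with probability exactly `1/5` at some reduced spacing in `(0.9, 1)`
(`erfc 0.9 > 1/5 > erfc 1`, intermediate value theorem). [ours] -/
theorem exists_erfc_eq_one_fifth : ∃ u ∈ Ioo (9 / 10 : ℝ) 1, erfc u = 1 / 5 := by
  have hIVT := intermediate_value_Ioo' (show (9 / 10 : ℝ) ≤ 1 by norm_num) continuous_erfc.continuousOn
  obtain ⟨u, hu, h⟩ := hIVT ⟨erfc_one_lt, erfc_09_gt⟩
  exact ⟨u, hu, h⟩

/-- **`u₂₀`**: the reduced spacing at which the Gaussian-model swap acceptance is the card's target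
`0.20` (unique, `erfc_eq_one_fifth_iff`). [ours] -/
def uTwenty : ℝ := exists_erfc_eq_one_fifth.choose

/-- `0.9 < u₂₀ < 1`. [ours] -/
theorem uTwenty_mem_Ioo : uTwenty ∈ Ioo (9 / 10 : ℝ) 1 := exists_erfc_eq_one_fifth.choose_spec.1

/-- `erfc u₂₀ = 1/5`. [ours] -/
theorem erfc_uTwenty : erfc uTwenty = 1 / 5 := exists_erfc_eq_one_fifth.choose_spec.2

/-- Uniqueness: `erfc u = 1/5 ↔ u = u₂₀` (`erfc` is strictly decreasing). [ours] -/
theorem erfc_eq_one_fifth_iff {u : ℝ} : erfc u = 1 / 5 ↔ u = uTwenty := by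
  rw [← erfc_uTwenty]
  exact strictAnti_erfc.injective.eq_iff

/-- **The `20 %` ladder is more widely spaced than the optimal one**: `u⋆ < 0.87 < 0.9 < u₂₀` — at equal
total stiffness it uses FEWER replicas than the ESJD optimum (`N_r − 1 = Λ/(2√2·u)`). [ours] -/
theorem uOpt_lt_uTwenty : uOpt < uTwenty := by
  linarith [uOpt_mem_Ioo_082_087.2, uTwenty_mem_Ioo.1]

/-- `swapEff u₂₀ = u₂₀²/5`. [ours] -/
theorem swapEff_uTwenty : swapEff uTwenty = uTwenty ^ 2 / 5 := by
  simp only [swapEff, erfc_uTwenty]; ring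

/-- **`swapEff u₂₀ > 0.162`** (`u₂₀ > 0.9`). [ours] -/
theorem swapEff_uTwenty_gt : (0.162 : ℝ) < swapEff uTwenty := by
  rw [swapEff_uTwenty]
  have h := uTwenty_mem_Ioo.1
  nlinarith

/-- **THE CARD'S `0.20` RETAINS MORE THAN `92 %` OF THE OPTIMAL EFFICIENCY** (model):
`swapEff u₂₀ > 0.162 > 0.92 · 0.17449 > 0.92 · swapEff u⋆`. [ours] -/
theorem swapEff_uTwenty_gt_mul_swapEff_uOpt : 0.92 * swapEff uOpt < swapEff uTwenty := by
  linarith [swapEff_uOpt_lt, swapEff_uTwenty_gt]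

/-- Equivalently in physical units: the ESJD at the `20 %` spacing exceeds `92 %` of the maximal ESJD.
[ours] -/
theorem swapESJD_twenty_gt : 0.92 * swapESJD optSpacing < swapESJD (2 * sqrt 2 * uTwenty) := by
  rw [swapESJD_eq, swapESJD_eq, optSpacing_div, mul_div_cancel_left₀ _ two_mul_sqrt_two_pos.ne']
  linarith [swapEff_uTwenty_gt_mul_swapEff_uOpt]

end Twenty

end Summit.Ventures.LatticeQCDFlow.Scaling

end
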